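import Mathlib.LinearAlgebra.TensorProduct.RightExactness
import Mathlib.LinearAlgebra.TensorProduct.Tower
import Mathlib.LinearAlgebra.Dimension.StrongRankCondition
import Mathlib.LinearAlgebra.Dimension.Finrank
import Mathlib.LinearAlgebra.FreeModule.StrongRankCondition
import Mathlib.LinearAlgebra.Quotient.Basic
import Mathlib.RingTheory.TensorProduct.Finite
import Mathlib.RingTheory.Finiteness.Basic
import Mathlib.RingTheory.Noetherian.Basic
import Mathlib.RingTheory.PrincipalIdealDomain
import Mathlib.Algebra.EuclideanDomain.Int
import Mathlib.Data.ZMod.Basic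
import HarnessLib

/-!
# Lowering coinvariants of integral weight modules with divided-power operators
# (`hyperalgebraCoinvariants`, the torsion ranks `d_p`)

Topic `Literature/RepresentationTheory/GeneralLinear`; definition request
`defn-hyperalgebraCoinvariants` (route ValiantsHypothesis/IntegralGCT, crux
`CoinvariantTorsionFlip`, item stmt-ValiantsHypothesis-1000).

## Mathematics

Let `U_ℤ = U_ℤ(gl_N)` be Kostant's `ℤ`-form of the enveloping algebra of `gl_N(ℚ)`: the subring
generated by the divided powers `E_ij^(k) = E_ij^k / k!` (`i ≠ j`, `k ≥ 0`) together with the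
binomials `binom(E_ii, k)`; it is free over `ℤ` with the Kostant (PBW) basis
`f_A h_B e_C` and factors as `U_ℤ = U_ℤ⁻ U_ℤ⁰ U_ℤ⁺` (Humphreys 1972, §26.4 Theorem (Kostant),
§27.1); it is the algebra of distributions (hyperalgebra) `Dist(GL_N, ℤ)` (Jantzen 2003,
II.1.12). A `U_ℤ`-stable lattice `Λ` in a finite-dimensional `gl_N(ℚ)`-module ("admissible
lattice") is the direct sum of its weight components `Λ_μ = Λ ∩ V_μ`, `μ ∈ ℤ^N`
(Humphreys 1972, §27.1 Theorem (a)), and the root operators shift weights,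
`E_ij^(k) Λ_μ ⊆ Λ_{μ + k(ε_i - ε_j)}`.

For such a `Λ` the **lowering coinvariants** are
`Coinv(Λ) = Λ ⧸ Σ_{i > j, k ≥ 1} E_ij^(k) Λ = Λ ⧸ (U_ℤ⁻)⁺ Λ`,
a `ℤ^N`-graded finitely generated abelian group (`H₀` of the "hyperalgebra Borel"); for a
commutative ring `R`, `hyperalgebraCoinvariants Λ R μ = R ⊗_ℤ Coinv(Λ)_μ`, and for a prime `p`
`d_p(Λ, μ) = dim_{𝔽_p} (𝔽_p ⊗ Coinv(Λ)_μ) = rank_ℤ Coinv(Λ)_μ + #{p-torsion cyclic factors of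
Coinv(Λ)_μ}`. Over `ℚ`, `dim (Λ_ℚ ⧸ 𝔫⁻Λ_ℚ)_μ` is the multiplicity in `Λ_ℚ` of the irreducible
`gl_N(ℚ)`-module of highest weight `μ` (Borel of upper-triangular matrices: `E_ij`, `i > j`, are
the negative root vectors), so `d_0(Λ, μ) = rank_ℤ Coinv(Λ)_μ` is that multiplicity and
`d_p ≥ d_0` with equality iff `Coinv(Λ)_μ` has no `p`-torsion.

## What is here (the abstract layer)

* `KostantModule R N Λ` — the DATA of such a module over a commutative base ring `R`
  (`R = ℤ` for lattices, `R = 𝔽_p, ℚ, ℂ` for their reductions / the ambient module): a weight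
  grading `weightSpace : (N → ℤ) → Submodule R Λ` and a family of `R`-linear operators
  `divPow i j k : Λ →ₗ[R] Λ` (the action of `E_ij^(k)`; only `i ≠ j` is ever used — the torus
  acts through the grading). As requested by the route, NO relations (Kostant/Serre commutation
  rules, weight shifts, direct-sum decomposition) are imposed: every notion below is a plain
  quotient/tensor construction that makes sense for arbitrary data, and the honest instances
  (`Literature/RepresentationTheory/GeneralLinear/OrbitLatticeCoinvariants.lean`: the integral
  coordinate ring of `Sym^m` with `E_ij^(k)` = `t^k`-coefficient of the action of the
  elementary unipotent `1 + t E_ij`) carry the relations as theorems about them.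
* `loweringSpan`, `Coinvariants`, `coinvWeightSpace μ`, `hyperalgebraCoinvariants A μ`
  (base change to an `R`-algebra `A`), `torsionRank p μ = d_p` (for `R = ℤ`, `A = ZMod p`;
  `p = 0` gives the free rank `d_0`).
* `presentedCoinvWeightSpace K μ` / `presentedTorsionRank K p μ`: the same for the quotient
  lattice `Λ ⧸ K` presented inside `Λ`, i.e. `Λ ⧸ (K + loweringSpan)`; this needs no
  stability hypothesis on `K` and agrees with the coinvariants of the quotient module
  `quotient K hK` when `K` is stable (`presentedCoinvWeightSpace_eq`).
* constructors `quotient`, `restrict`, `baseChange`; morphisms `Hom`, the induced map on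
  coinvariants, and MONOTONICITY `torsionRank_le_of_surjective` (a morphism mapping `Λ_μ` onto
  `Λ'_μ` gives `d_p(Λ', μ) ≤ d_p(Λ, μ)`: right-exactness of coinvariants and of `𝔽_p ⊗ -`).

## Sources

* J. E. Humphreys, *Introduction to Lie Algebras and Representation Theory*, GTM 9 (1972),
  §26.4 Theorem (Kostant) (the `ℤ`-form and its basis), §27.1 Theorem (admissible lattices are
  sums of their weight components; existence).
* J. C. Jantzen, *Representations of Algebraic Groups*, 2nd ed. (2003), I.7.8–7.11, II.1.12
  (`Dist(G)`; `Dist(GL_N, ℤ) = U_ℤ`; divided powers acting through the comodule map).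
* K. Akin, D. A. Buchsbaum, J. Weyman, Adv. Math. 44 (1982) (Schur/Weyl modules over `ℤ`).

Not here: `U_ℤ` itself (Kostant's theorem, PBW), the identification of `d_0` with
highest-weight multiplicities (highest-weight theory over `ℚ`), Smith normal forms.
-/

noncomputable section
open scoped TensorProduct

namespace Literature.RepresentationTheory.GeneralLinear

universe u v w

/-- **Kostant-module data** on an `R`-module `Λ` indexed by `N` (think `N = Fin n`,
`gl_N`): a weight grading `weightSpace μ = Λ_μ` (`μ : N → ℤ`, an integral weight of the
diagonal torus) and the divided-power root operators `divPow i j k = E_ij^(k) = E_ij^k / k!`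
(`i ≠ j`; for `i = j` the field is never used). For `R = ℤ` and `Λ` an admissible
(`U_ℤ(gl_N)`-stable) lattice in a `gl_N(ℚ)`-module: the action of the generators `x_α^t / t!`
of Kostant's `ℤ`-form and the weight decomposition `Λ = ⊕_μ (Λ ∩ V_μ)` (Humphreys 1972 §27.1
Theorem (a)). Pure data: no commutation relations are recorded (they hold in the instances).
[cite: Humphreys1972, §26.4 Theorem (Kostant); §27.1 Theorem] -/
structure KostantModule (R : Type u) [CommRing R] (N : Type v) (Λ : Type w) [AddCommGroup Λ]
    [Module R Λ] where
  /-- The weight-`μ` component `Λ_μ`. -/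
  weightSpace : (N → ℤ) → Submodule R Λ
  /-- The divided-power operator `E_ij^(k)` acting on `Λ` (meaningful for `i ≠ j`). -/
  divPow : N → N → ℕ → Λ →ₗ[R] Λ

namespace KostantModule

variable {R : Type u} [CommRing R] {N : Type v} {Λ : Type w} [AddCommGroup Λ] [Module R Λ]

section Lowering

variable [LinearOrder N] (M : KostantModule R N Λ)

/-- The **lowering span** `(U⁻)⁺ Λ = Σ_{i > j, k ≥ 1} E_ij^(k) Λ`: the `R`-span of the images
of all lowering divided powers (negative root vectors `E_ij`, `i > j`, for the upper-triangular
Borel). [cite: Humphreys1972, §27.1 (U_ℤ⁻ with ℤ-basis f_A)] -/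
def loweringSpan : Submodule R Λ :=
  ⨆ (i : N) (j : N) (_ : j < i) (k : ℕ) (_ : 0 < k), LinearMap.range (M.divPow i j k)

/-- Each lowering divided power lands in the lowering span. [folklore] -/
theorem divPow_mem_loweringSpan {i j : N} (hij : j < i) {k : ℕ} (hk : 0 < k) (x : Λ) :
    M.divPow i j k x ∈ M.loweringSpan := by
  refine Submodule.mem_iSup_of_mem i (Submodule.mem_iSup_of_mem j
    (Submodule.mem_iSup_of_mem hij (Submodule.mem_iSup_of_mem k
      (Submodule.mem_iSup_of_mem hk ?_))))
  exact LinearMap.mem_range_self _ x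

/-- The lowering span is the least submodule containing all `E_ij^(k) x`, `i > j`, `k ≥ 1`.
[folklore] -/
theorem loweringSpan_le_iff {P : Submodule R Λ} :
    M.loweringSpan ≤ P ↔ ∀ i j : N, j < i → ∀ k : ℕ, 0 < k → ∀ x, M.divPow i j k x ∈ P := by
  simp only [loweringSpan, iSup_le_iff, LinearMap.range_le_iff_comap, Submodule.eq_top_iff',
    Submodule.mem_comap]

/-- The **lowering coinvariants** `Coinv(Λ) = Λ ⧸ Σ_{i>j, k≥1} E_ij^(k) Λ` (`H₀` of the divided-power
lowering algebra `U_ℤ⁻` with coefficients in `Λ`). [cite: Humphreys1972, §27.1] -/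
abbrev Coinvariants : Type w := Λ ⧸ M.loweringSpan

/-- The quotient map `Λ → Coinv(Λ)`. [folklore] -/
def coinvariantsMk : Λ →ₗ[R] M.Coinvariants := M.loweringSpan.mkQ

/-- `coinvariantsMk` is the quotient map. [folklore] -/
@[simp] theorem coinvariantsMk_apply (x : Λ) : M.coinvariantsMk x = Submodule.Quotient.mk x :=
  rfl

/-- `Coinv(Λ)` is generated by the classes of elements of `Λ`. [folklore] -/
theorem coinvariantsMk_surjective : Function.Surjective M.coinvariantsMk :=
  Submodule.mkQ_surjective _

/-- Lowering divided powers die in the coinvariants. [folklore] -/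
theorem coinvariantsMk_divPow {i j : N} (hij : j < i) {k : ℕ} (hk : 0 < k) (x : Λ) :
    M.coinvariantsMk (M.divPow i j k x) = 0 :=
  (Submodule.Quotient.mk_eq_zero _).2 (M.divPow_mem_loweringSpan hij hk x)

/-- The weight-`μ` component `Coinv(Λ)_μ` of the coinvariants: the image of `Λ_μ`.
(When the grading is a direct sum and the operators shift weights, `Coinv(Λ) = ⊕_μ Coinv(Λ)_μ`
and `Coinv(Λ)_μ = Λ_μ ⧸ Σ E_ij^(k) Λ_{μ - k(ε_i - ε_j)}`.)
[cite: Humphreys1972, §27.1 Theorem (a)] -/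
def coinvWeightSpace (μ : N → ℤ) : Submodule R M.Coinvariants :=
  (M.weightSpace μ).map M.coinvariantsMk
/-- **`hyperalgebraCoinvariants Λ A μ = A ⊗_R Coinv(Λ)_μ`**: the weight-`μ` lowering
coinvariants with coefficients extended to the `R`-algebra `A` (for a lattice, `R = ℤ` and
`A` any commutative ring, e.g. `𝔽_p`, `ℚ`). It is an `A`-module. This is the notion requested
as `hyperalgebraCoinvariants` by route ValiantsHypothesis/IntegralGCT.
[cite: Humphreys1972, §27.1] -/
abbrev hyperalgebraCoinvariants (A : Type*) [CommRing A] [Algebra R A] (μ : N → ℤ) : Type _ :=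
  A ⊗[R] M.coinvWeightSpace μ

end Lowering

/-- **The torsion rank `d_p(Λ, μ)`** of an integral Kostant module: the `𝔽_p`-dimension of
`𝔽_p ⊗_ℤ Coinv(Λ)_μ`, i.e. (for `Λ` finitely generated) the free rank of `Coinv(Λ)_μ` plus the
number of its `p`-torsion cyclic factors. Conventions: `p` is meant to be a prime; `p = 0`
gives `ZMod 0 = ℤ` and `d_0 = rank_ℤ Coinv(Λ)_μ` (the characteristic-zero multiplicity);
`p = 1` gives the zero ring and `d_1 = 0` (junk). [cite: Humphreys1972, §27.1] -/
def torsionRank [LinearOrder N] (M : KostantModule ℤ N Λ) (p : ℕ) (μ : N → ℤ) : ℕ :=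
  Module.finrank (ZMod p) (M.hyperalgebraCoinvariants (ZMod p) μ)

/-! ### Quotients, restrictions, base change -/

/-- A submodule `K ≤ Λ` is **stable** if every divided-power operator maps it into itself
(a sub-`U_ℤ`-module as far as the root operators are concerned). [folklore] -/
def IsStable (M : KostantModule R N Λ) (K : Submodule R Λ) : Prop :=
  ∀ (i j : N) (k : ℕ), K ≤ K.comap (M.divPow i j k)

/-- The quotient `Λ ⧸ K` by a stable submodule: weight components are the images of those of
`Λ`, operators are the induced ones. (For an admissible lattice and a `U_ℤ`-stable `K` this is
the quotient `U_ℤ`-module.) [folklore] -/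
def quotient (M : KostantModule R N Λ) (K : Submodule R Λ) (hK : M.IsStable K) :
    KostantModule R N (Λ ⧸ K) where
  weightSpace μ := (M.weightSpace μ).map K.mkQ
  divPow i j k := K.mapQ K (M.divPow i j k) (hK i j k)

/-- The operators of the quotient on classes. [folklore] -/
@[simp] theorem quotient_divPow_mk (M : KostantModule R N Λ) (K : Submodule R Λ)
    (hK : M.IsStable K) (i j : N) (k : ℕ) (x : Λ) :
    (M.quotient K hK).divPow i j k (Submodule.Quotient.mk x) =
      Submodule.Quotient.mk (M.divPow i j k x) := rfl

/-- The weight components of the quotient. [folklore] -/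
@[simp] theorem quotient_weightSpace (M : KostantModule R N Λ) (K : Submodule R Λ)
    (hK : M.IsStable K) (μ : N → ℤ) :
    (M.quotient K hK).weightSpace μ = (M.weightSpace μ).map K.mkQ := rfl

/-- Restriction to a stable submodule `P ≤ Λ` (e.g. one homogeneous degree of a graded
module): weight components intersected with `P`, operators restricted. [folklore] -/
def restrict (M : KostantModule R N Λ) (P : Submodule R Λ) (hP : M.IsStable P) :
    KostantModule R N P where
  weightSpace μ := (M.weightSpace μ).comap P.subtype
  divPow i j k := (M.divPow i j k).restrict fun _ hx => hP i j k hx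

/-- Base change `A ⊗_R Λ` to an `R`-algebra `A` (e.g. the flat mod-`p` reduction `𝔽_p ⊗_ℤ Λ` of a
lattice, a module for the hyperalgebra `𝔽_p ⊗ U_ℤ`). [cite: Humphreys1972, §27.3 (V(K) = M ⊗ K)] -/
def baseChange (A : Type*) [CommRing A] [Algebra R A] (M : KostantModule R N Λ) :
    KostantModule A N (A ⊗[R] Λ) where
  weightSpace μ := (M.weightSpace μ).baseChange A
  divPow i j k := (M.divPow i j k).baseChange A

/-! ### Presented quotient lattices -/

section Presented

variable [LinearOrder N] (M : KostantModule R N Λ)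

/-- Relations for the coinvariants of the quotient lattice `Λ ⧸ K` computed inside `Λ`:
`K + Σ_{i>j,k≥1} E_ij^(k) Λ`. [folklore] -/
def presentedRelations (K : Submodule R Λ) : Submodule R Λ := K ⊔ M.loweringSpan

/-- `Coinv(Λ ⧸ K)_μ` presented inside `Λ`: the image of `Λ_μ` in `Λ ⧸ (K + Σ E_ij^(k) Λ)`.
No stability hypothesis on `K` is needed to state this; when `K` is stable it is the
weight-`μ` coinvariant component of the quotient module (`presentedCoinvWeightSpace_eq`).
[folklore] -/
def presentedCoinvWeightSpace (K : Submodule R Λ) (μ : N → ℤ) :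
    Submodule R (Λ ⧸ M.presentedRelations K) :=
  (M.weightSpace μ).map (M.presentedRelations K).mkQ

/-- `A ⊗_R Coinv(Λ ⧸ K)_μ`, presented inside `Λ`. [folklore] -/
abbrev presentedHyperalgebraCoinvariants (K : Submodule R Λ) (A : Type*) [CommRing A]
    [Algebra R A] (μ : N → ℤ) : Type _ :=
  A ⊗[R] M.presentedCoinvWeightSpace K μ

/-- The lowering span of a stable quotient is the image of the lowering span. [folklore] -/
theorem loweringSpan_quotient (K : Submodule R Λ) (hK : M.IsStable K) :
    (M.quotient K hK).loweringSpan = M.loweringSpan.map K.mkQ := by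
  apply le_antisymm
  · rw [loweringSpan_le_iff]
    intro i j hij k hk x
    induction x using Submodule.Quotient.induction_on with
    | H x =>
      rw [quotient_divPow_mk]
      exact Submodule.mem_map_of_mem (M.divPow_mem_loweringSpan hij hk x)
  · rw [Submodule.map_le_iff_le_comap, loweringSpan_le_iff]
    intro i j hij k hk x
    rw [Submodule.mem_comap, Submodule.mkQ_apply, ← quotient_divPow_mk M K hK]
    exact (M.quotient K hK).divPow_mem_loweringSpan hij hk _

/-- For a stable `K`, the coinvariants of the quotient module `Λ ⧸ K` are `Λ ⧸ (K + Σ E Λ)`: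
the linear equivalence `Coinv(Λ ⧸ K) ≃ Λ ⧸ presentedRelations K` (third isomorphism theorem).
[folklore] -/
def coinvariantsQuotientEquiv (K : Submodule R Λ) (hK : M.IsStable K) :
    (M.quotient K hK).Coinvariants ≃ₗ[R] Λ ⧸ M.presentedRelations K :=
  (Submodule.Quotient.equiv _ _ (LinearEquiv.refl R _) (by
      rw [Submodule.map_equiv_eq_comap_symm]
      ext x
      simp only [Submodule.mem_comap, LinearEquiv.refl_symm, LinearEquiv.coe_coe,
        LinearEquiv.refl_apply, loweringSpan_quotient])).trans
    (Submodule.quotientQuotientEquivQuotientSup K M.loweringSpan)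

/-- `coinvariantsQuotientEquiv` on classes. [folklore] -/
@[simp] theorem coinvariantsQuotientEquiv_mk_mk (K : Submodule R Λ) (hK : M.IsStable K)
    (x : Λ) :
    M.coinvariantsQuotientEquiv K hK ((M.quotient K hK).coinvariantsMk (Submodule.Quotient.mk x))
      = Submodule.Quotient.mk x := rfl

/-- For a stable `K`, `Coinv(Λ ⧸ K)_μ` corresponds to the presented weight component under
`coinvariantsQuotientEquiv`. [folklore] -/
theorem presentedCoinvWeightSpace_eq (K : Submodule R Λ) (hK : M.IsStable K) (μ : N → ℤ) :
    M.presentedCoinvWeightSpace K μ =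
      ((M.quotient K hK).coinvWeightSpace μ).map
        (M.coinvariantsQuotientEquiv K hK).toLinearMap := by
  rw [coinvWeightSpace, quotient_weightSpace, ← Submodule.map_comp, ← Submodule.map_comp]
  exact congrArg (Submodule.map · (M.weightSpace μ)) (LinearMap.ext fun _ => rfl)

/-- Hence `A ⊗ Coinv(Λ ⧸ K)_μ ≃ A ⊗ (presented weight component)` for stable `K`. [folklore] -/
def presentedHyperalgebraCoinvariantsEquiv (K : Submodule R Λ) (hK : M.IsStable K)
    (A : Type*) [CommRing A] [Algebra R A] (μ : N → ℤ) :
    (M.quotient K hK).hyperalgebraCoinvariants A μ ≃ₗ[A]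
      M.presentedHyperalgebraCoinvariants K A μ :=
  LinearEquiv.baseChange R A _ _ <|
    (((M.quotient K hK).coinvWeightSpace μ).equivMapOfInjective _
      (M.coinvariantsQuotientEquiv K hK).injective).trans
      (LinearEquiv.ofEq _ _ (M.presentedCoinvWeightSpace_eq K hK μ).symm)

end Presented

/-- `d_p` of the quotient lattice `Λ ⧸ K`, presented inside `Λ`:
`dim_{𝔽_p} 𝔽_p ⊗ (image of Λ_μ in Λ ⧸ (K + Σ E_ij^(k) Λ))`. [folklore] -/
def presentedTorsionRank [LinearOrder N] (M : KostantModule ℤ N Λ) (K : Submodule ℤ Λ) (p : ℕ)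
    (μ : N → ℤ) : ℕ :=
  Module.finrank (ZMod p) (M.presentedHyperalgebraCoinvariants K (ZMod p) μ)

/-- For a stable `K`, the presented `d_p` is the `d_p` of the quotient module. [folklore] -/
theorem presentedTorsionRank_eq [LinearOrder N] (M : KostantModule ℤ N Λ) (K : Submodule ℤ Λ)
    (hK : M.IsStable K) (p : ℕ) (μ : N → ℤ) :
    M.presentedTorsionRank K p μ = (M.quotient K hK).torsionRank p μ :=
  (LinearEquiv.finrank_eq (M.presentedHyperalgebraCoinvariantsEquiv K hK (ZMod p) μ)).symm

/-! ### Morphisms and monotonicity (right-exactness of coinvariants) -/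

section Hom

variable {Λ' : Type*} [AddCommGroup Λ'] [Module R Λ']

/-- A **morphism of Kostant modules**: an `R`-linear map preserving weight components and
commuting with every divided-power operator (e.g. the restriction to admissible lattices of a
`gl_N`-equivariant map defined over `ℚ`). [folklore] -/
structure Hom (M : KostantModule R N Λ) (M' : KostantModule R N Λ') where
  /-- The underlying linear map. -/
  toLinearMap : Λ →ₗ[R] Λ'
  map_weightSpace_le : ∀ μ, (M.weightSpace μ).map toLinearMap ≤ M'.weightSpace μ
  comm : ∀ (i j : N) (k : ℕ), toLinearMap ∘ₗ M.divPow i j k = M'.divPow i j k ∘ₗ toLinearMap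

variable [LinearOrder N] {M : KostantModule R N Λ} {M' : KostantModule R N Λ'}

/-- A morphism maps the lowering span into the lowering span. [folklore] -/
theorem Hom.loweringSpan_le_comap (φ : Hom M M') :
    M.loweringSpan ≤ M'.loweringSpan.comap φ.toLinearMap := by
  rw [loweringSpan_le_iff]
  intro i j hij k hk x
  rw [Submodule.mem_comap, ← LinearMap.comp_apply, φ.comm, LinearMap.comp_apply]
  exact M'.divPow_mem_loweringSpan hij hk _

/-- The map `Coinv(Λ) → Coinv(Λ')` induced by a morphism. [folklore] -/
def Hom.coinvariantsMap (φ : Hom M M') : M.Coinvariants →ₗ[R] M'.Coinvariants :=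
  Submodule.mapQ _ _ φ.toLinearMap φ.loweringSpan_le_comap

/-- The induced map on classes. [folklore] -/
@[simp] theorem Hom.coinvariantsMap_mk (φ : Hom M M') (x : Λ) :
    φ.coinvariantsMap (M.coinvariantsMk x) = M'.coinvariantsMk (φ.toLinearMap x) := rfl

/-- The induced map respects weight components of the coinvariants. [folklore] -/
theorem Hom.map_coinvWeightSpace_le (φ : Hom M M') (μ : N → ℤ) :
    (M.coinvWeightSpace μ).map φ.coinvariantsMap ≤ M'.coinvWeightSpace μ := by
  rintro _ ⟨_, ⟨x, hx, rfl⟩, rfl⟩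
  exact ⟨φ.toLinearMap x, φ.map_weightSpace_le μ ⟨x, hx, rfl⟩, rfl⟩

/-- If a morphism maps `Λ_μ` ONTO `Λ'_μ`, it maps `Coinv(Λ)_μ` onto `Coinv(Λ')_μ`
(coinvariants are right exact). [folklore] -/
theorem Hom.map_coinvWeightSpace_eq (φ : Hom M M') {μ : N → ℤ}
    (hμ : (M.weightSpace μ).map φ.toLinearMap = M'.weightSpace μ) :
    (M.coinvWeightSpace μ).map φ.coinvariantsMap = M'.coinvWeightSpace μ := by
  refine le_antisymm (φ.map_coinvWeightSpace_le μ) ?_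
  rintro _ ⟨y, hy, rfl⟩
  rw [← hμ] at hy
  obtain ⟨x, hx, rfl⟩ := hy
  exact ⟨M.coinvariantsMk x, ⟨x, hx, rfl⟩, rfl⟩

/-- The weight-`μ` component map `Coinv(Λ)_μ → Coinv(Λ')_μ` of a morphism. [folklore] -/
def Hom.coinvWeightSpaceMap (φ : Hom M M') (μ : N → ℤ) :
    M.coinvWeightSpace μ →ₗ[R] M'.coinvWeightSpace μ :=
  φ.coinvariantsMap.restrict fun _ hx => φ.map_coinvWeightSpace_le μ ⟨_, hx, rfl⟩

/-- Onto on `Λ_μ` implies onto on `Coinv(-)_μ`. [folklore] -/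
theorem Hom.coinvWeightSpaceMap_surjective (φ : Hom M M') {μ : N → ℤ}
    (hμ : (M.weightSpace μ).map φ.toLinearMap = M'.weightSpace μ) :
    Function.Surjective (φ.coinvWeightSpaceMap μ) := by
  rintro ⟨y, hy⟩
  rw [← φ.map_coinvWeightSpace_eq hμ] at hy
  obtain ⟨x, hx, rfl⟩ := hy
  exact ⟨⟨x, hx⟩, rfl⟩

/-- The map `A ⊗ Coinv(Λ)_μ → A ⊗ Coinv(Λ')_μ` of a morphism. [folklore] -/
def Hom.hyperalgebraCoinvariantsMap (φ : Hom M M') (A : Type*) [CommRing A] [Algebra R A]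
    (μ : N → ℤ) : M.hyperalgebraCoinvariants A μ →ₗ[A] M'.hyperalgebraCoinvariants A μ :=
  (φ.coinvWeightSpaceMap μ).baseChange A

/-- Right-exactness: onto on `Λ_μ` implies onto on `A ⊗ Coinv(-)_μ`. [folklore] -/
theorem Hom.hyperalgebraCoinvariantsMap_surjective (φ : Hom M M') (A : Type*) [CommRing A]
    [Algebra R A] {μ : N → ℤ} (hμ : (M.weightSpace μ).map φ.toLinearMap = M'.weightSpace μ) :
    Function.Surjective (φ.hyperalgebraCoinvariantsMap A μ) :=
  LinearMap.lTensor_surjective A (φ.coinvWeightSpaceMap_surjective hμ)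

end Hom

/-- **Monotonicity of `d_p`.** If `Λ` is finitely generated over `ℤ` and a morphism of
Kostant modules maps `Λ_μ` onto `Λ'_μ`, then `d_p(Λ', μ) ≤ d_p(Λ, μ)` for every `p ≠ 1`: a
surjection of `U_ℤ⁻`-modules induces a surjection of coinvariants and `𝔽_p ⊗ -` is right
exact. (This is the soundness of the route's `d_p`-flip certificate, given the morphism.)
[folklore] -/
theorem torsionRank_le_of_surjective [LinearOrder N] {Λ' : Type*} [AddCommGroup Λ']
    [Module.Finite ℤ Λ] {M : KostantModule ℤ N Λ} {M' : KostantModule ℤ N Λ'} (φ : Hom M M')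
    {μ : N → ℤ} (hμ : (M.weightSpace μ).map φ.toLinearMap = M'.weightSpace μ) {p : ℕ}
    (hp : p ≠ 1) : M'.torsionRank p μ ≤ M.torsionRank p μ := by
  haveI : Nontrivial (ZMod p) := ZMod.nontrivial_iff.mpr hp
  haveI : Module.Finite ℤ M.Coinvariants := Module.Finite.quotient ℤ _
  haveI : IsNoetherian ℤ M.Coinvariants := isNoetherian_of_isNoetherianRing_of_finite ℤ _
  haveI : IsNoetherian ℤ (M.coinvWeightSpace μ) := isNoetherian_submodule' _
  haveI : Module.Finite ℤ (M.coinvWeightSpace μ) := Module.IsNoetherian.finite ℤ _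
  exact LinearMap.finrank_le_finrank_of_surjective (φ.hyperalgebraCoinvariantsMap_surjective _ hμ)

end KostantModule

end Literature.RepresentationTheory.GeneralLinear
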